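import Mathlib.FieldTheory.PurelyInseparable.Basic
import Literature.NumberTheory.EllipticCurves.IsogenySeparableFactorProofs
import Literature.NumberTheory.EllipticCurves.IsogenyCompProofs
import Literature.NumberTheory.EllipticCurves.FrobeniusSeparableProofs
import Literature.NumberTheory.EllipticCurves.FrobeniusTateModule
import HarnessLib

/-!
# Isogenies of elliptic curves over a finite field can be turned round (Silverman, *AEC*, III.6.1)

A *proofs* file over the prelude `Literature.NumberTheory.EllipticCurves.Isogeny` (D-0014: the
prelude's `Isogeny.nonempty_symm` and `IsIsogenous.symm` are named facts `def … : Prop`). It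
proves them **for elliptic curves over a finite field**, in every characteristic and for
inseparable isogenies as well:

* `WeierstrassCurve.Isogeny.nonempty_symm_of_finite`: an isogeny `φ : E → E'` over a finite field
  `k` admits an isogeny `E' → E` over `k`; `Isogeny.nonempty_symm_holds_of_finite`,
  `IsIsogenous.symm_of_finite`, `IsIsogenous.symm_holds_of_finite`, `isIsogenous_comm_of_finite`.

The tree already has the dual isogeny in characteristic `0`
(`Isogeny.nonempty_symm_of_charZero`, `IsogenyDualProofs`) and for separable isogenies in any
characteristic (`Isogeny.nonempty_symm_of_deg_le_card_ker`, `IsogenySeparableFactorProofs`);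
over a finite field the `q`-power Frobenius `E → E` is an inseparable isogeny, so neither
covers `Isogeny.nonempty_symm` there. This closes hypothesis `hsymm` of the reduction of Tate's
isogeny theorem for elliptic curves to the theory of abelian varieties
(`Literature.AlgebraicGeometry.Motives.isIsogenous_of_finite_iff_exists_tateModule_hom_ne_zero_of_named_facts`,
`Literature.AlgebraicGeometry.Motives.isIsogenous_iff_card_point_eq_of_named_facts`).

## The argument

Let `φ : E → E'` be an isogeny over the finite field `k` (`#k = q = p^d`), `n = #ker φ`,
`L = φ^* K̄(E') ⊆ K̄(E)` and `H = K̄(E)^{ker φ}` the fixed field of the translations `τ_T^*`,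
`T ∈ ker φ`.

1. (`Isogeny.exists_eq_comp_of_pullback_mem_pullbackField`) **Silverman, Thm. II.2.4(b) in the
   form of the proof of Cor. III.4.11**: if `ψ : E → E''` kills `ker φ` and
   `ψ^* x'', ψ^* y'' ∈ L`, then `ψ = λ ∘ φ` for an isogeny `λ : E' → E''` over `k` — the tree's
   `exists_eq_comp_of_ker_le_of_surjective` with the separability of `φ` replaced by the two
   memberships it was used for (proof otherwise verbatim).
2. (`Isogeny.exists_pow_mem_pullbackField_of_forall_transAlgHom_eq`) **`H/L` is purely
   inseparable**: `L ⊆ H` (`pullbackField_le_fixedField`), `K̄(E)/H` is separable of degree `n`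
   (Artin, Mathlib `FixedPoints`), `[K̄(E) : L]_s = n` (Thm. III.4.10(a), the tree's theorem
   `card_ker_eq_finSepDegree_holds`), so `[H : L]_s = 1` by the tower law
   (`Field.finSepDegree_mul_finSepDegree_of_isAlgebraic`) and every `z ∈ H` has
   `z^{p^m} ∈ L` for some `m` (`IsPurelyInseparable.pow_mem`).
3. (`exists_isogeny_apply_eq_frobenius_pow_zsmul`,
   `Isogeny.pullback_eq_pullback_zsmul_pow_of_apply_eq`) The isogeny `ψ_s = σ_q^s ∘ [n] : E → E`
   (`[n]` followed by `s` Frobenii, composed with the tree's `Isogeny.comp`) has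
   `ψ_s^* x = ([n]^* x)^{q^s}`, `ψ_s^* y = ([n]^* y)^{q^s}`: both sides take the value
   `x(n • P)^{q^s}` at almost every `P`, since `x(σ_q R) = x(R)^q`.
4. (`Isogeny.exists_isogeny_comp_eq_frobenius_pow_zsmul`) `[n]^* x, [n]^* y ∈ H`
   (`transAlgHom_pullbackX/Y`, as `ker φ ⊆ E[n]`), so by 2. and 3. `ψ_s^* x, ψ_s^* y ∈ L` for
   `s` large, and 1. gives `λ : E' → E` with `λ ∘ φ = σ_q^s ∘ [n]`.

Over an arbitrary field of characteristic `p` the same argument would go through with `[p^e]`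
in place of `σ_q^s`, granted `[p]^* K̄(E) ⊆ K̄(E)^p` (Silverman, Cor. III.5.5 via invariant
differentials), which the tree does not have; hence the restriction to finite base fields.

## References

* [SilvermanAEC2009] J. H. Silverman, *The Arithmetic of Elliptic Curves*, 2nd ed., GTM 106,
  Springer 2009: Thm. II.2.4(b), Cor. II.2.12, Thm. III.4.10(a)–(b), Cor. III.4.11 and its proof,
  Thm. III.6.1(a), Example III.4.6 (Frobenius), V.§2.

## Design

`noncomputable section`, `open scoped Classical`, universe `u`, `K̄ = AlgebraicClosure K`,
deliberate dot-notation extensions in `namespace WeierstrassCurve` (as the files built upon);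
theorems only, no definitions (the isogenies `σ_q^s ∘ [n]` enter through an existence statement).
-/

noncomputable section

open scoped Classical
open scoped Polynomial.Bivariate
open Polynomial

universe u

namespace WeierstrassCurve

open geomPoints

variable {K : Type u} [Field K] {W W' : WeierstrassCurve K}

/-! ## Silverman, *AEC*, Cor. III.4.11 from the inclusion of function fields (Thm. II.2.4(b)) -/

section Factor

variable [W.IsElliptic] {W'' : WeierstrassCurve K}

namespace Isogeny

/-- **Factoring an isogeny through another, from the inclusion of function fields** (Silverman,
*AEC*, Thm. II.2.4(b) with the proof of Cor. III.4.11, for a possibly inseparable `φ`). Let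
`φ : E → E'` and `ψ : E → E''` be isogenies over `K` with `ker φ ⊆ ker ψ` on `K̄`-points, `φ`
onto `E'(K̄)`, and `ψ^* x'', ψ^* y'' ∈ φ^* K̄(E')` (i.e. `ψ^* K̄(E'') ⊆ φ^* K̄(E')`). Then
`ψ = λ ∘ φ` for an isogeny `λ : E' → E''` over `K`. This is the tree's
`exists_eq_comp_of_ker_le_of_surjective` (`IsogenySeparableFactorProofs`) with its first step —
the deduction of the two memberships from "`φ` separable" — detached, proof otherwise verbatim:
`λ(φ P) := ψ(P)` is well defined, additive, `Γ_K`-equivariant with finite kernel `φ(ker ψ)`, and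
writing `ψ^* x'' = φ^* (g₁/h₁)`, `ψ^* y'' = φ^* (g₂/h₂)` and comparing values at `P` shows that
`λ` agrees with `(g₁/h₁, g₂/h₂)` at `φ P` for all `P` off a finite set.
[cite: SilvermanAEC2009, Thm. II.2.4(b) and Cor. III.4.11 (proof)] -/
theorem exists_eq_comp_of_pullback_mem_pullbackField [W'.IsElliptic] (φ : Isogeny W W')
    (hsurj : Function.Surjective φ) (ψ : Isogeny W W'')
    (hker : ∀ P : W.geomPoints, φ P = 0 → ψ P = 0)
    (hxL : ψ.pullbackX ∈ φ.pullbackField) (hyL : ψ.pullbackY ∈ φ.pullbackField) :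
    ∃ lam : Isogeny W' W'', ∀ P, ψ P = lam (φ P) := by
  -- `ψ^* x'' = φ^* (g₁/h₁)`, `ψ^* y'' = φ^* (g₂/h₂)`
  obtain ⟨u₀, hu₀⟩ := (φ.mem_pullbackField_iff _).mp hxL
  obtain ⟨v₀, hv₀⟩ := (φ.mem_pullbackField_iff _).mp hyL
  obtain ⟨g₁, h₁, hh₁, rfl⟩ := exists_eq_evalGeneric_div u₀
  obtain ⟨g₂, h₂, hh₂, rfl⟩ := exists_eq_evalGeneric_div v₀
  -- the map `λ`
  choose pre hpre using hsurj
  have hwd : ∀ P Q : W.geomPoints, φ P = φ Q → ψ P = ψ Q := by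
    intro P Q hPQ
    rw [← sub_eq_zero, ← map_sub]
    exact hker _ (by rw [map_sub, hPQ, sub_self])
  let lam : W'.geomPoints →+ W''.geomPoints :=
    { toFun := fun Q ↦ ψ (pre Q)
      map_zero' := by
        change ψ (pre 0) = 0
        rw [← map_zero ψ]
        exact hwd _ _ (by rw [hpre 0, map_zero])
      map_add' := fun Q₁ Q₂ ↦ by
        change ψ (pre (Q₁ + Q₂)) = ψ (pre Q₁) + ψ (pre Q₂)
        rw [← map_add]
        exact hwd _ _ (by rw [map_add, hpre, hpre, hpre]) }
  have hlam : ∀ P : W.geomPoints, lam (φ P) = ψ P := fun P ↦ hwd _ _ (hpre _)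
  -- the finite bad set of `P`'s
  set B : Set W.geomPoints :=
    {P | ¬ AgreesWithRationalMapAt W W'' ψ.rationalRep.P₁ ψ.rationalRep.Q₁ ψ.rationalRep.P₂
        ψ.rationalRep.Q₂ ψ P} ∪
      {P | ¬ AgreesWithRationalMapAt W W' φ.rationalRep.P₁ φ.rationalRep.Q₁ φ.rationalRep.P₂
        φ.rationalRep.Q₂ φ P} ∪
    φ ⁻¹' ({Q | Q ≠ 0 ∧ MvPolynomial.eval (xy Q) h₁ = 0} ∪
      {Q | Q ≠ 0 ∧ MvPolynomial.eval (xy Q) h₂ = 0} ∪ {0}) with hB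
  have hBfin : B.Finite := by
    refine (ψ.rationalRep.finite.union φ.rationalRep.finite).union ?_
    exact (((finite_setOf_eval_xy_eq_zero hh₁).union (finite_setOf_eval_xy_eq_zero hh₂)).union
      (Set.finite_singleton 0)).preimage' fun Q _ ↦ φ.finite_fibre Q
  -- agreement at `φ P` for `P ∉ B`
  have hagree : ∀ P ∉ B, AgreesWithRationalMapAt W' W'' g₁ h₁ g₂ h₂ lam (φ P) := by
    intro P hPB
    simp only [hB, Set.mem_union, Set.mem_preimage, Set.mem_setOf_eq,
      Set.mem_singleton_iff, not_or, not_not, not_and] at hPB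
    obtain ⟨⟨hPψ, hPφ⟩, ⟨hQ₁, hQ₂⟩, hQ0⟩ := hPB
    have hP0 : P ≠ 0 := (agreesWithRationalMapAt_iff.mp hPψ).1
    have hQ₁' : MvPolynomial.eval (xy (φ P)) h₁ ≠ 0 := fun h ↦ hQ₁ hQ0 h
    have hQ₂' : MvPolynomial.eval (xy (φ P)) h₂ ≠ 0 := fun h ↦ hQ₂ hQ0 h
    -- values at `P`
    have hvx : W.HasValueAt ψ.pullbackX P (xy (ψ P) 0) := ψ.hasValueAt_pullback_gen hPψ 0
    have hvy : W.HasValueAt ψ.pullbackY P (xy (ψ P) 1) := ψ.hasValueAt_pullback_gen hPψ 1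
    have hvx' : W.HasValueAt ψ.pullbackX P (MvPolynomial.eval (xy (φ P)) g₁ /
        MvPolynomial.eval (xy (φ P)) h₁) := by
      rw [← hu₀]
      exact HasValueAt.pullbackHom φ hPφ (hasValueAt_div hQ0 hQ₁')
    have hvy' : W.HasValueAt ψ.pullbackY P (MvPolynomial.eval (xy (φ P)) g₂ /
        MvPolynomial.eval (xy (φ P)) h₂) := by
      rw [← hv₀]
      exact HasValueAt.pullbackHom φ hPφ (hasValueAt_div hQ0 hQ₂')
    have ex := hvx.unique hP0 hvx'
    have ey := hvy.unique hP0 hvy'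
    -- `ψ P` is affine with these coordinates
    obtain ⟨-, -, -, h', e⟩ := agreesWithRationalMapAt_iff.mp hPψ
    rw [e, xy_some] at ex ey
    simp only [Matrix.cons_val_zero, Matrix.cons_val_one] at ex ey
    rw [agreesWithRationalMapAt_iff]
    refine ⟨hQ0, hQ₁', hQ₂', ex ▸ ey ▸ h', ?_⟩
    rw [hlam, e]
    congr 1
  refine ⟨{ toAddMonoidHom := lam
            isAlgebraic := ⟨g₁, h₁, g₂, h₂, ?_⟩
            equivariant := ?_
            finite_ker := ?_ }, fun P ↦ (hlam P).symm⟩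
  · -- the exceptional set is contained in `φ(B)`
    refine (hBfin.image φ).subset fun Q hQ ↦ ?_
    by_cases hPB : pre Q ∈ B
    · exact ⟨pre Q, hPB, hpre Q⟩
    · exact (hQ ((hpre Q) ▸ hagree (pre Q) hPB)).elim
  · intro σ Q
    change ψ (pre (σ • Q)) = σ • ψ (pre Q)
    rw [← ψ.map_smul]
    refine hwd _ _ ?_
    rw [hpre, φ.map_smul, hpre]
  · refine (ψ.finite_ker.image φ).subset fun Q hQ ↦ ⟨pre Q, ?_, hpre Q⟩
    have hQ' : ψ (pre Q) = 0 := hQ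
    simpa using hQ'

end Isogeny

end Factor

/-! ## `K̄(E)^{ker φ} / φ^* K̄(E')` is purely inseparable -/

section Inseparable

variable [W.IsElliptic] [W'.IsElliptic]

namespace Isogeny

variable (φ : Isogeny W W')

/-- **`K̄(E)^{ker φ}` is purely inseparable over `φ^* K̄(E')`**, elementwise: in characteristic
`p > 0`, if `z ∈ K̄(E)` is fixed by the translations `τ_T^*`, `T ∈ ker φ`, then
`z ^ (p ^ m) ∈ φ^* K̄(E')` for some `m`. Indeed `L = φ^* K̄(E') ⊆ H = K̄(E)^{ker φ}`
(`pullbackField_le_fixedField`), `K̄(E)/H` is Galois of degree `#ker φ` (Artin) and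
`[K̄(E) : L]_s = #ker φ` (Silverman, *AEC*, Thm. III.4.10(a), the tree's
`card_ker_eq_finSepDegree_holds`), so `[H : L]_s = 1` by the tower law for separable degrees,
i.e. `H/L` is purely inseparable. Silverman, *AEC*, Thm. III.4.10(a)–(b) and Cor. II.2.12 (every
map factors as a separable map after a Frobenius). [folklore] -/
theorem exists_pow_mem_pullbackField_of_forall_transAlgHom_eq (hp : (ringChar K).Prime)
    {z : W.geomFunctionField} (hz : ∀ T : W.geomPoints, φ T = 0 → W.transAlgHom T z = z) :
    ∃ m : ℕ, z ^ ringChar K ^ m ∈ φ.pullbackField := by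
  set Sg : Subgroup (W.geomFunctionField ≃ₐ[AlgebraicClosure K] W.geomFunctionField) :=
    (AddSubgroup.toSubgroup φ.toAddMonoidHom.ker).map W.transHom with hSg
  set L : IntermediateField (AlgebraicClosure K) W.geomFunctionField := φ.pullbackField with hL
  set H : IntermediateField (AlgebraicClosure K) W.geomFunctionField :=
    IntermediateField.fixedField Sg with hH
  have hzH : z ∈ H := φ.mem_fixedField_of_forall_transAlgHom_eq hz
  have hLH : L ≤ H := φ.pullbackField_le_fixedField
  -- finiteness of `K̄(E)/L` (Silverman II.2.4(a))
  haveI : FiniteDimensional L W.geomFunctionField := finiteDimensional_pullbackField_holds W W' φ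
  -- `#Sg = #ker φ`
  have hcardK : Nat.card (AddSubgroup.toSubgroup φ.toAddMonoidHom.ker) =
      Nat.card φ.toAddMonoidHom.ker :=
    Nat.card_congr (Equiv.subtypeEquiv Multiplicative.toAdd fun _ ↦ Iff.rfl)
  have hcard : Nat.card Sg = Nat.card φ.toAddMonoidHom.ker := by
    rw [hSg, Subgroup.card_map_of_injective transHom_injective, hcardK]
  haveI : Finite (AddSubgroup.toSubgroup φ.toAddMonoidHom.ker) :=
    Nat.finite_of_card_ne_zero (by
      rw [hcardK]; exact (Nat.card_pos (α := φ.toAddMonoidHom.ker)).ne')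
  haveI : Finite Sg := by
    rw [hSg]
    exact Finite.of_surjective _ (Subgroup.equivMapOfInjective _ _ transHom_injective).surjective
  letI : Fintype Sg := Fintype.ofFinite Sg
  -- Artin: `[K̄(E) : H] = #Sg`, and `K̄(E)/H` is separable
  have h1 : Module.finrank H W.geomFunctionField = Fintype.card Sg :=
    FixedPoints.finrank_eq_card Sg W.geomFunctionField
  have hsepH : Algebra.IsSeparable H W.geomFunctionField :=
    FixedPoints.isSeparable Sg W.geomFunctionField
  -- the tower `L ≤ H ≤ K̄(E)`, with `H` viewed over `L`
  set H' : IntermediateField L W.geomFunctionField := IntermediateField.extendScalars hLH with hH'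
  haveI hsepH' : Algebra.IsSeparable H' W.geomFunctionField := hsepH
  have h1' : Module.finrank H' W.geomFunctionField = Nat.card φ.toAddMonoidHom.ker := by
    rw [← hcard, Nat.card_eq_fintype_card, ← h1]
    rfl
  have hsepdeg : Field.finSepDegree L W.geomFunctionField = Nat.card φ.toAddMonoidHom.ker :=
    (card_ker_eq_finSepDegree_holds W W' φ).symm
  have htower := Field.finSepDegree_mul_finSepDegree_of_isAlgebraic L H' W.geomFunctionField
  rw [Field.finSepDegree_eq_finrank_of_isSeparable H' W.geomFunctionField, h1', hsepdeg] at htower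
  have hn : Nat.card φ.toAddMonoidHom.ker ≠ 0 := (Nat.card_pos (α := φ.toAddMonoidHom.ker)).ne'
  have hone : Field.finSepDegree L H' = 1 := (mul_eq_right₀ hn).mp htower
  haveI : IsPurelyInseparable L H' := isPurelyInseparable_of_finSepDegree_eq_one hone
  -- characteristic `p`
  haveI := charP_geomFunctionField W
  haveI : CharP L (ringChar K) :=
    RingHom.charP (algebraMap L W.geomFunctionField)
      (FaithfulSMul.algebraMap_injective L W.geomFunctionField) _
  haveI : ExpChar L (ringChar K) := ExpChar.prime hp
  have hzH' : z ∈ H' := (IntermediateField.mem_extendScalars hLH).mpr hzH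
  obtain ⟨m, w, hw⟩ := IsPurelyInseparable.pow_mem L (ringChar K) (⟨z, hzH'⟩ : H')
  refine ⟨m, ?_⟩
  have hw' := congrArg (fun t : H' ↦ (t : W.geomFunctionField)) hw
  simp only [SubmonoidClass.mk_pow] at hw'
  have hval : ((algebraMap L H' w : H') : W.geomFunctionField) = (w : W.geomFunctionField) := rfl
  rw [hval] at hw'
  rw [← hw']
  exact w.2

end Isogeny

end Inseparable

/-! ## The isogenies `σ_q^s ∘ [n] : E → E` and their pull-backs -/

section FrobeniusPower

variable {σ : Field.absoluteGaloisGroup K}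

/-- Galois automorphisms act on the coordinates of geometric points: `x(σ R) = σ (x R)`,
`y(σ R) = σ (y R)` (also at `R = O`, where both sides are the junk value `0`). [folklore] -/
theorem geomPoints.xy_absoluteGaloisGroup_smul (σ : Field.absoluteGaloisGroup K) (R : W.geomPoints)
    (i : Fin 2) : xy (σ • R) i = σ • xy R i := by
  cases R with
  | zero =>
    change xy (σ • (0 : W.geomPoints)) i = σ • xy (0 : W.geomPoints) i
    rw [smul_zero, xy_zero, Pi.zero_apply, smul_zero]
  | some a b h =>
    change xy (Affine.Point.map ((show AlgebraicClosure K ≃ₐ[K] AlgebraicClosure K from σ) :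
        AlgebraicClosure K →ₐ[K] AlgebraicClosure K) (Affine.Point.some a b h)) i = _
    rw [Affine.Point.map_some, xy_some, xy_some]
    fin_cases i <;> rfl

/-- The coordinates of `σ_q^s R` are the `q^s`-th powers of those of `R`, for the arithmetic
Frobenius `σ_q` (`σ_q c = c ^ q` on `k̄`). Silverman, *AEC*, V.§2 (`φ(x, y) = (x^q, y^q)`).
[folklore] -/
theorem geomPoints.xy_frobenius_pow_smul (hσ : ∀ x : AlgebraicClosure K, σ • x = x ^ Nat.card K)
    (s : ℕ) (R : W.geomPoints) (i : Fin 2) : xy (σ ^ s • R) i = xy R i ^ Nat.card K ^ s := by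
  induction s generalizing R with
  | zero => rw [pow_zero, one_smul, pow_zero, pow_one]
  | succ s ih =>
    rw [pow_succ, mul_smul, ih (σ • R), geomPoints.xy_absoluteGaloisGroup_smul, hσ, ← pow_mul,
      ← pow_succ']

variable (W) [W.IsElliptic]

/-- **The isogeny `σ_q^s ∘ [n] : E → E`** (`P ↦ σ_q^s (n • P)`) exists as a term of the prelude's
`Isogeny W W`: `[n]` (`Isogeny.zsmul`) followed by `s` copies of the `q`-power Frobenius isogeny
(`frobeniusIsogeny`, Silverman, *AEC*, III.4.6), composed with the tree's `Isogeny.comp`.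
[folklore] -/
theorem exists_isogeny_apply_eq_frobenius_pow_zsmul
    (hσ : ∀ x : AlgebraicClosure K, σ • x = x ^ Nat.card K) {n : ℤ} (hn : n ≠ 0) (s : ℕ) :
    ∃ ψ : Isogeny W W, ∀ P, ψ P = σ ^ s • (n • P) := by
  induction s with
  | zero => exact ⟨Isogeny.zsmul W n hn, fun P ↦ by rw [Isogeny.zsmul_apply, pow_zero, one_smul]⟩
  | succ s ih =>
    obtain ⟨ψ, hψ⟩ := ih
    refine ⟨(W.frobeniusIsogeny hσ).comp ψ, fun P ↦ ?_⟩
    rw [Isogeny.comp_apply, frobeniusIsogeny_apply, hψ, ← mul_smul, ← pow_succ']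

/-- **`(σ_q^s ∘ [n])^* x = ([n]^* x) ^ (q^s)` and `(σ_q^s ∘ [n])^* y = ([n]^* y) ^ (q^s)`**: both
sides have the value `x(n • P) ^ (q^s)` (resp. `y(n • P) ^ (q^s)`) at all but finitely many `P`
(`x(σ_q^s R) = x(R)^{q^s}`), and an element of `K̄(E)` is determined by its values at infinitely
many points. Silverman, *AEC*, II.§2 (`φ^* f = f ∘ φ`; the `q`-power Frobenius, II.2.10–2.11).
[folklore] -/
theorem Isogeny.pullback_eq_pullback_zsmul_pow_of_apply_eq
    (hσ : ∀ x : AlgebraicClosure K, σ • x = x ^ Nat.card K) {n : ℤ} (hn : n ≠ 0) {s : ℕ}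
    {ψ : Isogeny W W} (hψ : ∀ P, ψ P = σ ^ s • (n • P)) :
    ψ.pullbackX = (Isogeny.zsmul W n hn).pullbackX ^ Nat.card K ^ s ∧
      ψ.pullbackY = (Isogeny.zsmul W n hn).pullbackY ^ Nat.card K ^ s := by
  -- the good set: points of agreement of `ψ` with `n • P ≠ O`
  set B : Set W.geomPoints :=
    {P | ¬ AgreesWithRationalMapAt W W ψ.rationalRep.P₁ ψ.rationalRep.Q₁ ψ.rationalRep.P₂
        ψ.rationalRep.Q₂ ψ P} ∪ (geomTorsion W n : Set W.geomPoints) with hB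
  have hBfin : B.Finite := ψ.rationalRep.finite.union (finite_geomTorsion W hn)
  have hgood : ∀ P ∉ B, P ≠ 0 ∧ n • P ≠ 0 ∧
      AgreesWithRationalMapAt W W ψ.rationalRep.P₁ ψ.rationalRep.Q₁ ψ.rationalRep.P₂
        ψ.rationalRep.Q₂ ψ P := by
    intro P hP
    simp only [hB, Set.mem_union, Set.mem_setOf_eq, not_or, not_not, SetLike.mem_coe] at hP
    obtain ⟨hA, hT⟩ := hP
    exact ⟨(agreesWithRationalMapAt_iff.mp hA).1, fun h ↦ hT ((mem_torsionPoints_iff _ _ P).mpr h),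
      hA⟩
  constructor
  · apply eq_of_infinite_setOf_hasValueAt
    refine hBfin.infinite_compl.mono fun P hP ↦ ?_
    obtain ⟨hP0, hnP, hA⟩ := hgood P hP
    refine ⟨hP0, xy (n • P) 0 ^ Nat.card K ^ s, ?_, (hasValueAt_pullbackX_zsmul hn hnP).pow _⟩
    have h := ψ.hasValueAt_pullback_gen hA 0
    simp only [Matrix.cons_val_zero] at h
    rw [hψ, geomPoints.xy_frobenius_pow_smul hσ] at h
    exact h
  · apply eq_of_infinite_setOf_hasValueAt
    refine hBfin.infinite_compl.mono fun P hP ↦ ?_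
    obtain ⟨hP0, hnP, hA⟩ := hgood P hP
    refine ⟨hP0, xy (n • P) 1 ^ Nat.card K ^ s, ?_, (hasValueAt_pullbackY_zsmul hn hnP).pow _⟩
    have h := ψ.hasValueAt_pullback_gen hA 1
    simp only [Matrix.cons_val_one, Matrix.cons_val_zero] at h
    rw [hψ, geomPoints.xy_frobenius_pow_smul hσ] at h
    exact h

end FrobeniusPower

/-! ## The dual direction of an isogeny over a finite field -/

section Dual

variable [Finite K]

/-- From `z ^ (p ^ c) ∈ L` to `z ^ (q ^ m) ∈ L` for `m ≥ c`, where `q = #k = p ^ d`, `d ≥ 1`.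
[folklore] -/
theorem pow_natCard_pow_mem_of_pow_ringChar_pow_mem
    {L : IntermediateField (AlgebraicClosure K) W.geomFunctionField} {z : W.geomFunctionField}
    {c : ℕ} (hz : z ^ ringChar K ^ c ∈ L) {m : ℕ} (hcm : c ≤ m) :
    z ^ Nat.card K ^ m ∈ L := by
  obtain ⟨d, -, hq, hd⟩ := exists_natCard_eq_ringChar_pow K
  have hle : c ≤ d * m := le_trans hcm (Nat.le_mul_of_pos_left m hd)
  obtain ⟨e, he⟩ := Nat.exists_eq_add_of_le hle
  have hzq : z ^ Nat.card K ^ m = (z ^ ringChar K ^ c) ^ ringChar K ^ e := by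
    rw [hq, ← pow_mul, he, pow_add, pow_mul]
  rw [hzq]
  exact pow_mem hz _

variable [W.IsElliptic] [W'.IsElliptic]

/-- **Every isogeny of elliptic curves over a finite field can be turned round**: for
`φ : E → E'` over `k` finite, with `n = #ker φ` and `σ_q` the arithmetic Frobenius, there are
`s ≥ 0` and an isogeny `λ : E' → E` over `k` with `λ ∘ φ = σ_q^s ∘ [n]`, i.e.
`λ (φ P) = σ_q^s (n • P)`. (For `φ` separable `s = 0` works and `λ = φ̂` is the dual isogeny,
Silverman, *AEC*, Thm. III.6.1(a); in general `φ = λ' ∘ F^e` with `λ'` separable, Cor. II.2.12,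
and `λ = F^{ds-e} ∘ λ̂'` up to automorphism — here obtained directly: `[n]^* x, [n]^* y` are
fixed by the translations by `ker φ ⊆ E[n]`, so suitable `q^s`-th powers lie in `φ^* K̄(E')`
(`exists_pow_mem_pullbackField_of_forall_transAlgHom_eq`), these powers are the pull-backs of
`x, y` along `σ_q^s ∘ [n]` (`pullback_eq_pullback_zsmul_pow_of_apply_eq`), and the inclusion of
function fields factors `σ_q^s ∘ [n]` through `φ`
(`exists_eq_comp_of_pullback_mem_pullbackField`, Thm. II.2.4(b)).)
[cite: SilvermanAEC2009, Thm. III.6.1(a) and Cor. II.2.12] -/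
theorem Isogeny.exists_isogeny_comp_eq_frobenius_pow_zsmul (φ : Isogeny W W')
    {σ : Field.absoluteGaloisGroup K} (hσ : ∀ x : AlgebraicClosure K, σ • x = x ^ Nat.card K) :
    ∃ (s : ℕ) (lam : Isogeny W' W), ∀ P,
      lam (φ P) = σ ^ s • ((Nat.card φ.toAddMonoidHom.ker : ℤ) • P) := by
  set n : ℤ := ((Nat.card φ.toAddMonoidHom.ker : ℕ) : ℤ) with hn
  have hn0 : n ≠ 0 := Int.natCast_ne_zero.mpr (Nat.card_pos (α := φ.toAddMonoidHom.ker)).ne'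
  -- `[n]` kills `ker φ` (Lagrange)
  have hker0 : ∀ T : W.geomPoints, φ T = 0 → n • T = 0 := by
    intro T hT
    have hT' : T ∈ φ.toAddMonoidHom.ker := hT
    have h0 := congrArg Subtype.val (card_nsmul_eq_zero' (x := (⟨T, hT'⟩ : φ.toAddMonoidHom.ker)))
    simp only [AddSubgroupClass.coe_nsmul, ZeroMemClass.coe_zero] at h0
    rw [hn, natCast_zsmul]
    exact h0
  have hkerz : ∀ T : W.geomPoints, φ T = 0 → Isogeny.zsmul W n hn0 T = 0 := fun T hT ↦ by
    rw [Isogeny.zsmul_apply, hker0 T hT]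
  obtain ⟨-, hp, -, -⟩ := exists_natCard_eq_ringChar_pow K
  -- `[n]^* x`, `[n]^* y` are fixed by the kernel translations, hence have a `p`-power in `L`
  obtain ⟨m₁, hm₁⟩ := φ.exists_pow_mem_pullbackField_of_forall_transAlgHom_eq hp
    fun T hT ↦ (Isogeny.zsmul W n hn0).transAlgHom_pullbackX (hkerz T hT)
  obtain ⟨m₂, hm₂⟩ := φ.exists_pow_mem_pullbackField_of_forall_transAlgHom_eq hp
    fun T hT ↦ (Isogeny.zsmul W n hn0).transAlgHom_pullbackY (hkerz T hT)
  -- the isogeny `σ_q^s ∘ [n]` with `s = m₁ + m₂` has its pull-backs in `L`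
  obtain ⟨ψ, hψ⟩ := exists_isogeny_apply_eq_frobenius_pow_zsmul W hσ hn0 (m₁ + m₂)
  obtain ⟨hx, hy⟩ := Isogeny.pullback_eq_pullback_zsmul_pow_of_apply_eq W hσ hn0 hψ
  have hxL : ψ.pullbackX ∈ φ.pullbackField := by
    rw [hx]
    exact pow_natCard_pow_mem_of_pow_ringChar_pow_mem hm₁ (Nat.le_add_right m₁ m₂)
  have hyL : ψ.pullbackY ∈ φ.pullbackField := by
    rw [hy]
    exact pow_natCard_pow_mem_of_pow_ringChar_pow_mem hm₂ (Nat.le_add_left m₂ m₁)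
  have hker : ∀ P : W.geomPoints, φ P = 0 → ψ P = 0 := fun P hP ↦ by
    rw [hψ, hker0 P hP, smul_zero]
  -- factor through `φ`
  obtain ⟨lam, hlam⟩ := φ.exists_eq_comp_of_pullback_mem_pullbackField φ.surjective ψ hker hxL hyL
  exact ⟨m₁ + m₂, lam, fun P ↦ by rw [← hlam, hψ]⟩

/-- **Isogeny of elliptic curves over a finite field is symmetric**: an isogeny `E → E'` over a
finite field `k` admits an isogeny `E' → E` over `k` (the body of the named fact
`Isogeny.nonempty_symm` of `Literature.NumberTheory.EllipticCurves.Isogeny`, for elliptic curves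
over finite fields; the tree has it in characteristic `0`, `nonempty_symm_of_charZero`, and for
separable isogenies, `nonempty_symm_of_deg_le_card_ker`). Silverman, *AEC*, Thm. III.6.1(a)
(dual isogeny). [cite: SilvermanAEC2009, Thm. III.6.1(a)] -/
theorem Isogeny.nonempty_symm_of_finite (φ : Isogeny W W') : Nonempty (Isogeny W' W) := by
  obtain ⟨σ, hσ⟩ := exists_frobenius_absoluteGaloisGroup K
  obtain ⟨-, lam, -⟩ := φ.exists_isogeny_comp_eq_frobenius_pow_zsmul hσ
  exact ⟨lam⟩

variable (W W') in
/-- The named fact `Isogeny.nonempty_symm` (for the pair `(W, W')`) holds when `K` is finite and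
`W, W'` are elliptic. Silverman, *AEC*, Thm. III.6.1(a). [cite: SilvermanAEC2009, Thm. III.6.1(a)] -/
theorem Isogeny.nonempty_symm_holds_of_finite : Isogeny.nonempty_symm (W := W) (W' := W') :=
  fun φ ↦ φ.nonempty_symm_of_finite

/-- **`IsIsogenous` is symmetric for elliptic curves over a finite field.** Silverman, *AEC*,
Thm. III.6.1(a), III.6.2. [cite: SilvermanAEC2009, Thm. III.6.1(a)] -/
theorem IsIsogenous.symm_of_finite (h : W.IsIsogenous W') : W'.IsIsogenous W :=
  h.elim fun φ ↦ φ.nonempty_symm_of_finite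

variable (W W') in
/-- The named fact `IsIsogenous.symm` (for the pair `(W, W')`) holds when `K` is finite and
`W, W'` are elliptic. Silverman, *AEC*, Thm. III.6.1(a). [cite: SilvermanAEC2009, Thm. III.6.1(a)] -/
theorem IsIsogenous.symm_holds_of_finite : IsIsogenous.symm (W := W) (W' := W') :=
  fun h ↦ h.symm_of_finite

/-- Over a finite field, isogeny of elliptic curves is an equivalence in both directions:
`E ~ E' ↔ E' ~ E`. [folklore] -/
theorem isIsogenous_comm_of_finite : W.IsIsogenous W' ↔ W'.IsIsogenous W :=
  ⟨IsIsogenous.symm_of_finite, IsIsogenous.symm_of_finite⟩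

end Dual

end WeierstrassCurve
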